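import Literature.Geometry.Symplectic.PALFCollarProduct
import Literature.Geometry.Symplectic.PALFInwardFields
import Literature.Topology.FourManifolds.CollarTheorem
import Mathlib.Analysis.SpecialFunctions.SmoothTransition
import HarnessLib

/-!
# The collar levels of the regular fibre of a Lefschetz fibration over the disc

Topic `Literature/Geometry/Symplectic` (fact seat
`provefact-Literature.Geometry.Symplectic.Oba2016_s-add47373d4`; second brick of the fibre-page
statement `hF` of `kasHandleCount_of_planarFibreMorse`, Kas 1980 §2 / Gompf–Stipsicz 1999 §8.2).
For a PALF `f : W → 𝔻²` (`Literature.Geometry.Symplectic.PALF`), a regular value `c₀` in the open disc and flow-out data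
`D` (collar coordinate `σ = D.f`), the levels `{x ∈ F(c₀) | σ x = t}` of the collar coordinate on
the fibre `F(c₀) = f⁻¹(c₀)`, `0 < t` small, are homeomorphic to the boundary
`∂F(c₀) = F(c₀) ∩ ∂W` of the fibre, read on the boundary manifold `b.carrier ≅ ∂W`:

* `exists_smooth_recip_floor` — a smooth `η : ℝ → ℝ` with `η s = 1/s` for `s ≥ m₀ > 0`;
* `PALF.exists_flowoutInput_mfderiv_eq_zero` — **fibre-preserving flow-out data**: flow-out data
  `D'` with the same collar coordinate `σ` whose field is tangent to the fibres of `f`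
  (`df(ξ') = 0`) over the disc of radius `r < 1` below some level `s > 0` (the kernel field `ν`
  of `PALF.exists_kernel_field_inward`, normalised to `dσ(ν) = 1` and glued to `D.ξ`);
* `PALF.apply_Fl_eq_of_apply_eq` — along the flow-out of `D'` from a point of `F(c₀)`,
  `‖c₀‖ < r`, the value of `f` stays `c₀` (as long as `σ` stays below `s`);
* `PALF.nonempty_homeomorph_fibreLevel_boundaryLevel` — **for `0 < t ≤ t₀`,
  `{x ∈ W | f x = c₀ ∧ σ x = t} ≃ₜ {y ∈ ∂W | f y = c₀}`** (flow out for time `t`; inverse the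
  retraction along the flow);
* `PALF.nonempty_homeomorph_fibreCollar_prod` — **the collar of the fibre is a product**:
  `{x ∈ W | f x = c₀ ∧ σ x ≤ t₀} ≃ₜ {y ∈ ∂W | f y = c₀} × [0, t₀]`.

Everything is proved; no definitions, no named facts.

## References

* A. Kas, *On the handlebody decomposition associated to a Lefschetz fibration*, Pacific J.
  Math. 89 (1980), §2. [Kas1980]
* J. Milnor, *Lectures on the h-cobordism theorem* (1965), proof of Thm. 3.4 (the flow-out
  collar). [MilnorHCobordism1965]
-/

open scoped Manifold ContDiff Topology RealInnerProductSpace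
open Set Function Filter

noncomputable section

namespace Literature.Geometry.Symplectic

open Literature.Topology.FourManifolds

universe u

/-! ### §1 A smooth reciprocal with a floor -/

/-- For `m₀ > 0` there is a smooth `η : ℝ → ℝ` with `η s = s⁻¹` for `s ≥ m₀` (invert the
smooth function `m₀/2 + (s - m₀/2) · smoothTransition ((s - m₀/2)/(m₀/2)) ≥ m₀/2`, which is
`s` for `s ≥ m₀`). [folklore] -/
theorem exists_smooth_recip_floor {m₀ : ℝ} (hm₀ : 0 < m₀) :
    ∃ η : ℝ → ℝ, ContDiff ℝ ∞ η ∧ ∀ s, m₀ ≤ s → η s = s⁻¹ := by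
  set ρ : ℝ → ℝ := fun s => m₀ / 2 + (s - m₀ / 2) * Real.smoothTransition ((s - m₀ / 2) / (m₀ / 2))
    with hρ
  have hρs : ContDiff ℝ ∞ ρ := by
    refine contDiff_const.add ((contDiff_id.sub contDiff_const).mul ?_)
    exact Real.smoothTransition.contDiff.comp ((contDiff_id.sub contDiff_const).div_const _)
  have hρpos : ∀ s, m₀ / 2 ≤ ρ s := by
    intro s
    show m₀ / 2 ≤ m₀ / 2 + (s - m₀ / 2) * Real.smoothTransition ((s - m₀ / 2) / (m₀ / 2))
    rcases le_or_gt (s - m₀ / 2) 0 with h | h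
    · have : Real.smoothTransition ((s - m₀ / 2) / (m₀ / 2)) = 0 :=
        Real.smoothTransition.zero_of_nonpos (div_nonpos_of_nonpos_of_nonneg h (by linarith))
      rw [this, mul_zero, add_zero]
    · have := mul_nonneg h.le (Real.smoothTransition.nonneg ((s - m₀ / 2) / (m₀ / 2)))
      linarith
  have hρeq : ∀ s, m₀ ≤ s → ρ s = s := by
    intro s hs
    show m₀ / 2 + (s - m₀ / 2) * Real.smoothTransition ((s - m₀ / 2) / (m₀ / 2)) = s
    rw [Real.smoothTransition.one_of_one_le, mul_one]
    · ring
    · rw [le_div_iff₀ (by linarith)]; linarith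
  refine ⟨fun s => (ρ s)⁻¹, hρs.inv fun s => ?_, fun s hs => by simp only [hρeq s hs]⟩
  linarith [hρpos s]

variable {W : Type u} [TopologicalSpace W] [ChartedSpace (EuclideanHalfSpace 4) W]
  [IsManifold (𝓡∂ 4) ∞ W] [T2Space W] [CompactSpace W]
  {o : SmoothOrientation (𝓡∂ 4) W} {b : BoundaryData (𝓡∂ 4) W (𝓡 3)}

namespace PALF

/-! ### §2 Fibre-preserving flow-out data -/

/-- **Fibre-preserving flow-out data** (Kas 1980, §2: near `∂F` the collar of `W` may be taken
inside the fibres).  Given flow-out data `D` and `0 < r < 1`, there are flow-out data `D'` with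
the same collar coordinate `σ` and a level `s > 0` such that `df(ξ') = 0` wherever
`‖f‖ ≤ r` and `σ ≤ s`: `ξ' = (1 - a) D.ξ + a · η(dσ(ν)) ν` with `ν` the inward kernel field over
the disc of radius `r' = (r + 1)/2` (`PALF.exists_kernel_field_inward`), `η(dσ(ν)) = 1/dσ(ν)` on
the support of the cut-off `a = χ(f) ψ(σ)`. [cite: Kas1980, §2] -/
theorem exists_flowoutInput_mfderiv_eq_zero (P : PALF o b) (D : FlowoutInput 3 W) {r : ℝ}
    (hr0 : 0 < r) (hr1 : r < 1) :
    ∃ (D' : FlowoutInput 3 W) (s : ℝ), 0 < s ∧ (∀ x, D'.f x = D.f x) ∧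
      ∀ x, ‖P.f x‖ ≤ r → D.f x ≤ s →
        mfderiv (𝓡∂ 4) 𝓘(ℝ, EuclideanSpace ℝ (Fin 2)) P.f x (D'.ξ x) = 0 := by
  -- the kernel field over the larger disc and its `σ`-derivative near the boundary
  set r' : ℝ := (r + 1) / 2 with hr'
  have hrr' : r < r' := by rw [hr']; linarith
  have hr'1 : r' < 1 := by rw [hr']; linarith
  obtain ⟨ν, hνs, -, hνk, hνin⟩ := P.exists_kernel_field_inward hr'1
  obtain ⟨s₁, hs₁, hs₁ν⟩ := P.exists_pos_forall_mlineDeriv_pos D hνs hνin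
  -- a positive floor for `dσ(ν)` on the compact support region
  set K : Set W := {x | ‖P.f x‖ ≤ r' ∧ D.f x ≤ 3 * s₁ / 4} with hK
  have hKc : IsCompact K :=
    ((isClosed_le (continuous_norm.comp P.contMDiff.continuous) continuous_const).inter
      (isClosed_le D.f_smooth.continuous continuous_const)).isCompact
  have hdc : Continuous fun x => mlineDeriv (𝓡∂ 4) D.f x (ν x) :=
    (contMDiff_mlineDeriv_section D.f_smooth hνs).continuous
  have hKpos : ∀ x ∈ K, 0 < mlineDeriv (𝓡∂ 4) D.f x (ν x) := fun x hx =>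
    hs₁ν x hx.1 (by linarith [hx.2])
  obtain ⟨m₀, hm₀, hm₀le⟩ : ∃ m₀ : ℝ, 0 < m₀ ∧ ∀ x ∈ K, m₀ ≤ mlineDeriv (𝓡∂ 4) D.f x (ν x) := by
    by_cases hne : K.Nonempty
    · obtain ⟨x₀, hx₀, hmin⟩ := hKc.exists_isMinOn hne hdc.continuousOn
      exact ⟨_, hKpos x₀ hx₀, fun x hx => isMinOn_iff.1 hmin x hx⟩
    · exact ⟨1, one_pos, fun x hx => absurd ⟨x, hx⟩ hne⟩
  obtain ⟨η, hηs, hηeq⟩ := exists_smooth_recip_floor hm₀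
  -- the cut-offs
  set χ : ContDiffBump (0 : EuclideanSpace ℝ (Fin 2)) := ⟨r, r', hr0, hrr'⟩ with hχ
  set ψ : ContDiffBump (0 : ℝ) := ⟨s₁ / 2, 3 * s₁ / 4, by linarith, by linarith⟩ with hψ
  set a : W → ℝ := fun x => χ (P.f x) * ψ (D.f x) with ha
  have has : ContMDiff (𝓡∂ 4) 𝓘(ℝ, ℝ) ∞ a :=
    (χ.contDiff.comp_contMDiff P.contMDiff).mul (ψ.contDiff.comp_contMDiff D.f_smooth)
  have ha_mem : ∀ x, a x ≠ 0 → x ∈ K := by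
    intro x hx
    have h1 : χ (P.f x) ≠ 0 := left_ne_zero_of_mul hx
    have h2 : ψ (D.f x) ≠ 0 := right_ne_zero_of_mul hx
    constructor
    · by_contra h
      push Not at h
      exact h1 (χ.zero_of_le_dist (by rw [dist_zero_right]; exact h.le))
    · by_contra h
      push Not at h
      exact h2 (ψ.zero_of_le_dist (by
        rw [dist_zero_right, Real.norm_eq_abs, abs_of_nonneg (D.f_nonneg x)]; exact h.le))
  have ha_one : ∀ x, ‖P.f x‖ ≤ r → D.f x ≤ s₁ / 2 → a x = 1 := by
    intro x h1 h2
    show χ (P.f x) * ψ (D.f x) = 1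
    rw [χ.one_of_mem_closedBall (by rwa [Metric.mem_closedBall, dist_zero_right]),
      ψ.one_of_mem_closedBall (by
        rw [Metric.mem_closedBall, dist_zero_right, Real.norm_eq_abs, abs_of_nonneg (D.f_nonneg x)]
        exact h2), one_mul]
  -- the normalising factor and the field
  set w : W → ℝ := fun x => η (mlineDeriv (𝓡∂ 4) D.f x (ν x)) with hw
  have hws : ContMDiff (𝓡∂ 4) 𝓘(ℝ, ℝ) ∞ w :=
    hηs.comp_contMDiff (contMDiff_mlineDeriv_section D.f_smooth hνs)
  have hw_mul : ∀ x ∈ K, w x * mlineDeriv (𝓡∂ 4) D.f x (ν x) = 1 := by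
    intro x hx
    show η (mlineDeriv (𝓡∂ 4) D.f x (ν x)) * mlineDeriv (𝓡∂ 4) D.f x (ν x) = 1
    rw [hηeq _ (hm₀le x hx), inv_mul_cancel₀ (hKpos x hx).ne']
  set ξ' : Π x : W, TangentSpace (𝓡∂ 4) x := fun x => D.ξ x + a x • (w x • ν x - D.ξ x) with hξ'
  have hξ's : ContMDiff (𝓡∂ 4) (𝓡∂ 4).tangent ∞ (fun x => (⟨x, ξ' x⟩ : TangentBundle (𝓡∂ 4) W)) :=
    D.ξ_smooth.add_section (has.smul_section ((hws.smul_section hνs).sub_section D.ξ_smooth))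
  -- `dσ(ξ') = 1` below `min δ (s₁/2)`
  have hσ : ∀ z, D.f z ≤ min D.δ (s₁ / 2) → mlineDeriv (𝓡∂ 4) D.f z (ξ' z) = 1 := by
    intro z hz
    have hzδ : D.f z ≤ D.δ := hz.trans (min_le_left _ _)
    have hzs : D.f z ≤ s₁ / 2 := hz.trans (min_le_right _ _)
    have h1 := D.mlineDeriv_f_ξ z hzδ
    set L := mfderiv (𝓡∂ 4) 𝓘(ℝ, ℝ) D.f z with hL
    have e : mlineDeriv (𝓡∂ 4) D.f z (ξ' z) =
        mlineDeriv (𝓡∂ 4) D.f z (D.ξ z) +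
          a z * (w z * mlineDeriv (𝓡∂ 4) D.f z (ν z) - mlineDeriv (𝓡∂ 4) D.f z (D.ξ z)) := by
      simp only [mlineDeriv_def]
      have e1 := L.map_add (D.ξ z) (a z • (w z • ν z - D.ξ z))
      have e2 := L.map_smul (a z) (w z • ν z - D.ξ z)
      have e3 := L.map_sub (w z • ν z) (D.ξ z)
      have e4 := L.map_smul (w z) (ν z)
      rw [e3, e4] at e2
      rw [e2] at e1
      exact e1
    rw [e, h1]
    by_cases haz : a z = 0
    · rw [haz]; ring
    · rw [hw_mul z (ha_mem z haz)]; ring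
  have hδ' : 0 < min D.δ (s₁ / 2) := lt_min D.δ_pos (by linarith)
  let D' : FlowoutInput 3 W :=
    ⟨D.f, ξ', min D.δ (s₁ / 2), hδ', D.f_smooth, D.f_nonneg, D.f_eq_zero_iff, hξ's, hσ⟩
  refine ⟨D', s₁ / 2, by linarith, fun x => rfl, fun x hxr hxs => ?_⟩
  -- `df(ξ') = 0` where `a = 1` and `df(ν) = 0`
  show mfderiv (𝓡∂ 4) 𝓘(ℝ, EuclideanSpace ℝ (Fin 2)) P.f x (ξ' x) = 0
  set Lf := mfderiv (𝓡∂ 4) 𝓘(ℝ, EuclideanSpace ℝ (Fin 2)) P.f x with hLf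
  have e1 : Lf (ξ' x) = Lf (D.ξ x) + Lf (w x • ν x - D.ξ x) := by
    show Lf (D.ξ x + a x • (w x • ν x - D.ξ x)) = _
    rw [ha_one x hxr hxs, one_smul]
    exact Lf.map_add _ _
  have e3 := Lf.map_sub (w x • ν x) (D.ξ x)
  have e4 := Lf.map_smul (w x) (ν x)
  rw [e1, e3, e4, hνk x (hxr.trans hrr'.le), smul_zero, zero_sub]
  exact add_neg_cancel _

/-! ### §3 `f` is preserved along the fibre-preserving flow-out -/

omit [IsManifold (𝓡∂ 4) ∞ W] [T2Space W] [CompactSpace W] in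
/-- The derivative of a smooth vector-valued map along an integral curve, within the time set.
[folklore] -/
theorem hasDerivWithinAt_comp_of_isMIntegralCurveOn {g : W → EuclideanSpace ℝ (Fin 2)}
    (hg : ContMDiff (𝓡∂ 4) 𝓘(ℝ, EuclideanSpace ℝ (Fin 2)) ∞ g)
    {ξ : Π x : W, TangentSpace (𝓡∂ 4) x} {γ : ℝ → W} {J : Set ℝ} (hγ : IsMIntegralCurveOn γ ξ J)
    {t : ℝ} (ht : t ∈ J) :
    HasDerivWithinAt (g ∘ γ) (mfderiv (𝓡∂ 4) 𝓘(ℝ, EuclideanSpace ℝ (Fin 2)) g (γ t) (ξ (γ t))) J t := by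
  have h1 : HasMFDerivWithinAt 𝓘(ℝ, ℝ) 𝓘(ℝ, EuclideanSpace ℝ (Fin 2)) (g ∘ γ) J t
      ((mfderiv (𝓡∂ 4) 𝓘(ℝ, EuclideanSpace ℝ (Fin 2)) g (γ t)).comp
        ((1 : ℝ →L[ℝ] ℝ).smulRight (ξ (γ t)))) :=
    ((hg.mdifferentiableAt (by simp)).hasMFDerivAt).comp_hasMFDerivWithinAt t (hγ t ht)
  have h2 : HasFDerivWithinAt (g ∘ γ)
      ((mfderiv (𝓡∂ 4) 𝓘(ℝ, EuclideanSpace ℝ (Fin 2)) g (γ t)).comp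
        ((1 : ℝ →L[ℝ] ℝ).smulRight (ξ (γ t))) : ℝ →L[ℝ] EuclideanSpace ℝ (Fin 2)) J t :=
    hasMFDerivWithinAt_iff_hasFDerivWithinAt.1 h1
  have h3 : ((mfderiv (𝓡∂ 4) 𝓘(ℝ, EuclideanSpace ℝ (Fin 2)) g (γ t)).comp
        ((1 : ℝ →L[ℝ] ℝ).smulRight (ξ (γ t))) : ℝ →L[ℝ] EuclideanSpace ℝ (Fin 2)) =
      (1 : ℝ →L[ℝ] ℝ).smulRight
        (mfderiv (𝓡∂ 4) 𝓘(ℝ, EuclideanSpace ℝ (Fin 2)) g (γ t) (ξ (γ t))) := by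
    apply ContinuousLinearMap.ext_ring
    show mfderiv (𝓡∂ 4) 𝓘(ℝ, EuclideanSpace ℝ (Fin 2)) g (γ t) ((1 : ℝ) • ξ (γ t)) =
      (1 : ℝ) • mfderiv (𝓡∂ 4) 𝓘(ℝ, EuclideanSpace ℝ (Fin 2)) g (γ t) (ξ (γ t))
    rw [one_smul, one_smul]
  exact hasDerivWithinAt_iff_hasFDerivWithinAt.2 (h2.congr_fderiv h3)

omit [T2Space W] [CompactSpace W] in
/-- **`f` is constant along the flow-out of fibre-preserving flow-out data** (as long as the
collar coordinate stays below the preservation level `s` and the starting value lies in the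
open disc of radius `r`): for `Γ` a flow-out cover of `D'`, `‖f z‖ < r`, `σ z ≤ a`,
`t ∈ [-σ z, a]` with `σ z, σ z + t ≤ s`, one has `f (Fl z t) = f z`.  (Along the integral curve
`u ↦ Fl z u` the function `‖f - f z‖²` has derivative `2⟪f - f z, df(ξ')⟫`, which vanishes
while `‖f‖ ≤ r`; a connectedness argument on the time interval between `0` and `t`.)
[cite: Kas1980, §2] -/
theorem apply_Fl_eq (P : PALF o b) {D' : FlowoutInput 3 W} (Γ : D'.Cover) {r s : ℝ}
    (hpres : ∀ x, ‖P.f x‖ ≤ r → D'.f x ≤ s →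
      mfderiv (𝓡∂ 4) 𝓘(ℝ, EuclideanSpace ℝ (Fin 2)) P.f x (D'.ξ x) = 0)
    {z : W} (hza : D'.f z ≤ Γ.a) (hzr : ‖P.f z‖ < r) (hzs : D'.f z ≤ s)
    {t : ℝ} (ht : t ∈ Icc (-D'.f z) Γ.a) (hts : D'.f z + t ≤ s) :
    P.f (Γ.Fl z t) = P.f z := by
  set γ : ℝ → W := Γ.Fl z with hγdef
  set J : Set ℝ := Icc (-D'.f z) Γ.a with hJ
  have hγ : IsMIntegralCurveOn γ D'.ξ J := Γ.isMIntegralCurveOn_Fl hza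
  set c : EuclideanSpace ℝ (Fin 2) := P.f z with hc
  set g : ℝ → ℝ := fun u => ‖P.f (γ u) - c‖ ^ 2 with hg
  have h0J : (0 : ℝ) ∈ J := ⟨by linarith [D'.f_nonneg z], Γ.a_pos.le⟩
  -- the time interval between `0` and `t`
  set J₀ : Set ℝ := uIcc 0 t with hJ₀
  have hJ₀J : J₀ ⊆ J := uIcc_subset_Icc h0J ht
  have hσJ₀ : ∀ u ∈ J₀, D'.f (γ u) ≤ s := by
    intro u hu
    rw [Γ.f_Fl hza (hJ₀J hu)]
    rcases le_total 0 t with h0t | h0t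
    · rw [hJ₀, uIcc_of_le h0t] at hu; linarith [hu.2]
    · rw [hJ₀, uIcc_of_ge h0t] at hu; linarith [hu.2]
  -- the derivative of `g` within `J`
  have hfγ : ∀ u ∈ J, HasDerivWithinAt (fun u => P.f (γ u) - c)
      (mfderiv (𝓡∂ 4) 𝓘(ℝ, EuclideanSpace ℝ (Fin 2)) P.f (γ u) (D'.ξ (γ u))) J u :=
    fun u hu => (hasDerivWithinAt_comp_of_isMIntegralCurveOn P.contMDiff hγ hu).sub_const c
  have hgd : ∀ u ∈ J, HasDerivWithinAt g
      (2 * ⟪P.f (γ u) - c, mfderiv (𝓡∂ 4) 𝓘(ℝ, EuclideanSpace ℝ (Fin 2)) P.f (γ u) (D'.ξ (γ u))⟫) J u := by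
    intro u hu
    have h := (hfγ u hu).norm_sq
    simpa using h
  have hgc : ContinuousOn g J := fun u hu => (hgd u hu).continuousWithinAt
  -- where `g` is small and `σ ≤ s`, the derivative vanishes
  have hε₀ : 0 < r - ‖c‖ := by rw [hc]; linarith
  have hgzero : ∀ u ∈ J, g u < (r - ‖c‖) ^ 2 → D'.f (γ u) ≤ s → HasDerivWithinAt g 0 J u := by
    intro u hu hgu hσu
    have hn : ‖P.f (γ u) - c‖ < r - ‖c‖ := by
      by_contra h
      push Not at h
      have : (r - ‖c‖) ^ 2 ≤ ‖P.f (γ u) - c‖ ^ 2 := pow_le_pow_left₀ hε₀.le h 2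
      exact absurd hgu (not_lt.2 this)
    have hr' : ‖P.f (γ u)‖ ≤ r := by
      have := norm_le_norm_sub_add (P.f (γ u)) c
      linarith
    have h := hgd u hu
    have h0 : mfderiv (𝓡∂ 4) 𝓘(ℝ, EuclideanSpace ℝ (Fin 2)) P.f (γ u) (D'.ξ (γ u)) =
        (0 : EuclideanSpace ℝ (Fin 2)) := hpres (γ u) hr' hσu
    rw [h0, inner_zero_right, mul_zero] at h
    exact h
  -- connectedness: `g = 0` on `J₀`
  have hg0 : g 0 = 0 := by
    show ‖P.f (Γ.Fl z 0) - c‖ ^ 2 = 0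
    rw [Γ.Fl_zero hza, hc, sub_self, norm_zero]; ring
  set U : Set ℝ := {u | ∀ᶠ u' in 𝓝 u, u' ∈ J₀ → g u' = 0} with hU
  have hUo : IsOpen U := isOpen_setOf_eventually_nhds
  set V : Set ℝ := (J₀ ∩ g ⁻¹' {0})ᶜ with hV
  have hVo : IsOpen V := by
    rw [hV, isOpen_compl_iff]
    exact (hgc.mono hJ₀J).preimage_isClosed_of_isClosed isClosed_Icc isClosed_singleton
  have hstep : ∀ u ∈ J₀, g u = 0 → u ∈ U := by
    intro u hu hgu
    -- near `u`, within `J`, `g` stays small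
    have hsmall : ∀ᶠ u' in 𝓝[J] u, g u' < (r - ‖c‖) ^ 2 :=
      (hgc u (hJ₀J hu)).eventually (gt_mem_nhds (by rw [hgu]; positivity))
    rw [eventually_nhdsWithin_iff, Metric.eventually_nhds_iff] at hsmall
    obtain ⟨δ, hδ, hδg⟩ := hsmall
    show ∀ᶠ u' in 𝓝 u, u' ∈ J₀ → g u' = 0
    rw [Metric.eventually_nhds_iff]
    refine ⟨δ, hδ, fun u' hu' hu'J₀ => ?_⟩
    -- on the convex set `C = J₀ ∩ ball u δ` the derivative of `g` within `C` vanishes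
    set C : Set ℝ := J₀ ∩ Metric.ball u δ with hC
    have hCconv : Convex ℝ C := (convex_uIcc 0 t).inter (convex_ball u δ)
    have hCJ : C ⊆ J := fun x hx => hJ₀J hx.1
    have hderivC : ∀ x ∈ C, HasFDerivWithinAt g (0 : ℝ →L[ℝ] ℝ) C x := by
      intro x hx
      have hxg : g x < (r - ‖c‖) ^ 2 := hδg (Metric.mem_ball.1 hx.2) (hCJ hx)
      have h := (hgzero x (hCJ hx) hxg (hσJ₀ x hx.1)).mono hCJ
      have h' := h.hasFDerivWithinAt
      simpa using h'
    have hbound : ∀ x ∈ C, ‖(0 : ℝ →L[ℝ] ℝ)‖ ≤ 0 := fun _ _ => by simp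
    have huC : u ∈ C := ⟨hu, Metric.mem_ball_self hδ⟩
    have hu'C : u' ∈ C := ⟨hu'J₀, hu'⟩
    have h := hCconv.norm_image_sub_le_of_norm_hasFDerivWithin_le hderivC hbound huC hu'C
    rw [zero_mul, norm_le_zero_iff, sub_eq_zero] at h
    rw [h, hgu]
  have hJ₀pre : IsPreconnected J₀ := isPreconnected_uIcc
  have hcover : J₀ ⊆ U ∪ V := by
    intro u hu
    by_cases hgu : g u = 0
    · exact Or.inl (hstep u hu hgu)
    · exact Or.inr fun h => hgu h.2
  have hdisj : J₀ ∩ (U ∩ V) = ∅ := by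
    ext u
    simp only [mem_inter_iff, mem_empty_iff_false, iff_false, not_and]
    intro hu huU huV
    have h1 : g u = 0 := (huU.self_of_nhds) hu
    exact huV ⟨hu, h1⟩
  have hsub : J₀ ⊆ U := by
    rcases (isPreconnected_iff_subset_of_disjoint.1 hJ₀pre) U V hUo hVo hcover hdisj with h | h
    · exact h
    · exfalso
      have h0 : (0 : ℝ) ∈ J₀ := left_mem_uIcc
      exact h h0 ⟨h0, hg0⟩
  have hgt : g t = 0 := (hsub right_mem_uIcc).self_of_nhds right_mem_uIcc
  have : ‖P.f (γ t) - c‖ = 0 := by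
    have h := hgt
    simp only [hg] at h
    exact pow_eq_zero_iff two_ne_zero |>.1 h
  exact sub_eq_zero.1 (norm_eq_zero.1 this)

/-! ### §4 The collar levels of the fibre are homeomorphic to its boundary -/

omit [T2Space W] [CompactSpace W] in
/-- The boundary manifold of the total space of a PALF is nonempty (the vertical boundary
`{‖f‖ = 1}` is). [folklore] -/
theorem nonempty_carrier (P : PALF o b) : Nonempty b.carrier := by
  obtain ⟨x, hx⟩ := P.exists_apply_eq (c := EuclideanSpace.single 0 1) (by simp)
  have hxb : x ∈ (𝓡∂ 4).boundary W := P.mem_boundary_of_norm_eq_one (by rw [hx]; simp)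
  rw [← b.range_incl] at hxb
  obtain ⟨y, -⟩ := hxb
  exact ⟨y⟩

/-- **The collar levels of the regular fibre are homeomorphic to its boundary** (Kas 1980, §2:
near `∂W` the fibre `F(c₀)` is the product `∂F(c₀) × [0, t₀]`).  For flow-out data `D` (collar
coordinate `σ = D.f`) and `‖c₀‖ < 1` there is `t₀ > 0` such that for `0 < t ≤ t₀` the level
`{x ∈ W | f x = c₀ ∧ σ x = t}` is homeomorphic to the boundary level `{y ∈ ∂W | f y = c₀}`:
flow out along the fibre-preserving flow-out data of `exists_flowoutInput_mfderiv_eq_zero` for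
time `t` (`f` is preserved, `apply_Fl_eq`; `σ` becomes `t`), and retract back.
[cite: Kas1980, §2] [cite: MilnorHCobordism1965, proof of Thm. 3.4] -/
theorem nonempty_homeomorph_fibreLevel_boundaryLevel (P : PALF o b) (D : FlowoutInput 3 W)
    {c₀ : EuclideanSpace ℝ (Fin 2)} (hc₀ : ‖c₀‖ < 1) :
    ∃ t₀ : ℝ, 0 < t₀ ∧ ∀ t ∈ Ioc 0 t₀,
      Nonempty ({x : W // P.f x = c₀ ∧ D.f x = t} ≃ₜ {y : b.carrier // P.f (b.incl y) = c₀}) := by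
  haveI : Nonempty b.carrier := P.nonempty_carrier
  -- fibre-preserving flow-out data over a disc containing `c₀`
  set r : ℝ := (‖c₀‖ + 1) / 2 with hr
  have hr0 : 0 < r := by rw [hr]; linarith [norm_nonneg c₀]
  have hr1 : r < 1 := by rw [hr]; linarith
  have hc₀r : ‖c₀‖ < r := by rw [hr]; linarith
  obtain ⟨D', s, hs, hfeq, hpres0⟩ := P.exists_flowoutInput_mfderiv_eq_zero D hr0 hr1
  have hpres : ∀ x, ‖P.f x‖ ≤ r → D'.f x ≤ s →
      mfderiv (𝓡∂ 4) 𝓘(ℝ, EuclideanSpace ℝ (Fin 2)) P.f x (D'.ξ x) = 0 :=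
    fun x h1 h2 => hpres0 x h1 (by rw [← hfeq]; exact h2)
  obtain ⟨Γ⟩ := D'.nonempty_cover
  set O := Γ.openCollarData b with hO
  refine ⟨min (Γ.a / 2) s, lt_min (by linarith [Γ.a_pos]) hs, fun t ht => ?_⟩
  have ht0 : 0 < t := ht.1
  have hta : t < Γ.a := lt_of_le_of_lt (ht.2.trans (min_le_left _ _)) (by linarith [Γ.a_pos])
  have hts : t ≤ s := ht.2.trans (min_le_right _ _)
  -- boundary points: `σ = 0`
  have hσ0 : ∀ y : b.carrier, D'.f (b.incl y) = 0 := fun y => D'.f_incl b y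
  -- forward: flow out for time `t`
  have hto : ∀ y : {y : b.carrier // P.f (b.incl y) = c₀},
      P.f (Γ.Fl (b.incl y.1) t) = c₀ ∧ D.f (Γ.Fl (b.incl y.1) t) = t := by
    intro y
    have hza : D'.f (b.incl y.1) ≤ Γ.a := by rw [hσ0]; exact Γ.a_pos.le
    have htI : t ∈ Icc (-D'.f (b.incl y.1)) Γ.a := by rw [hσ0, neg_zero]; exact ⟨ht0.le, hta.le⟩
    constructor
    · rw [P.apply_Fl_eq Γ hpres hza (by rw [y.2]; exact hc₀r) (by rw [hσ0]; exact hs.le) htI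
        (by rw [hσ0, zero_add]; exact hts), y.2]
    · rw [← hfeq, Γ.f_Fl hza htI, hσ0, zero_add]
  -- backward: retract
  have hfro : ∀ x : {x : W // P.f x = c₀ ∧ D.f x = t}, P.f (b.incl (b.inclInv (Γ.ret x.1))) = c₀ := by
    intro x
    have hσx : D'.f x.1 = t := by rw [hfeq]; exact x.2.2
    have hxa : D'.f x.1 ≤ Γ.a := by rw [hσx]; exact hta.le
    rw [b.incl_inclInv (Γ.ret_mem_boundary hxa)]
    show P.f (Γ.Fl x.1 (-D'.f x.1)) = c₀
    rw [P.apply_Fl_eq Γ hpres hxa (by rw [x.2.1]; exact hc₀r) (by rw [hσx]; exact hts)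
      ⟨le_rfl, by linarith [D'.f_nonneg x.1, Γ.a_pos]⟩ (by rw [add_neg_cancel]; exact hs.le), x.2.1]
  have ha0 : Γ.a ≠ 0 := Γ.a_pos.ne'
  refine ⟨{ toFun := fun x => ⟨b.inclInv (Γ.ret x.1), hfro x⟩
            invFun := fun y => ⟨Γ.Fl (b.incl y.1) t, hto y⟩
            left_inv := fun x => ?_
            right_inv := fun y => ?_
            continuous_toFun := ?_
            continuous_invFun := ?_ }⟩
  · apply Subtype.ext
    have hσx : D'.f x.1 = t := by rw [hfeq]; exact x.2.2
    have hxa : D'.f x.1 ≤ Γ.a := by rw [hσx]; exact hta.le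
    show Γ.Fl (b.incl (b.inclInv (Γ.ret x.1))) t = x.1
    rw [b.incl_inclInv (Γ.ret_mem_boundary hxa)]
    have h := Γ.Fl_ret hxa
    rw [hσx] at h
    exact h
  · apply Subtype.ext
    show b.inclInv (Γ.ret (Γ.Fl (b.incl y.1) t)) = y.1
    rw [Γ.ret_Fl (hσ0 y.1) ⟨ht0.le, hta.le⟩, b.inclInv_incl]
  · have hcont : ContinuousOn O.proj O.region := O.contMDiffOn_proj.continuousOn
    have h1 : Continuous fun x : {x : W // P.f x = c₀ ∧ D.f x = t} => O.proj x.1 := by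
      refine hcont.comp_continuous continuous_subtype_val fun x => ?_
      show D'.f x.1 < Γ.a
      rw [hfeq, x.2.2]; exact hta
    exact h1.subtype_mk _
  · -- continuity of the flow-out at the fixed time `t = (2t/a) · (a/2)`
    have hcont : ContinuousOn (uncurry O.toFun) (univ ×ˢ Ico 0 O.top) := O.contMDiffOn_toFun.continuousOn
    have htop : 2 * t / Γ.a ∈ Ico (0 : ℝ) O.top := by
      show 2 * t / Γ.a ∈ Ico (0 : ℝ) 2
      refine ⟨div_nonneg (by linarith) Γ.a_pos.le, ?_⟩
      rw [div_lt_iff₀ Γ.a_pos]; linarith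
    have h1 : Continuous fun y : {y : b.carrier // P.f (b.incl y) = c₀} =>
        uncurry O.toFun (y.1, 2 * t / Γ.a) :=
      hcont.comp_continuous (continuous_subtype_val.prodMk continuous_const)
        fun y => ⟨mem_univ _, htop⟩
    have h2 : (fun y : {y : b.carrier // P.f (b.incl y) = c₀} => Γ.Fl (b.incl y.1) t) =
        fun y => uncurry O.toFun (y.1, 2 * t / Γ.a) := by
      funext y
      show Γ.Fl (b.incl y.1) t = Γ.Fl (b.incl y.1) (2 * t / Γ.a * (Γ.a / 2))
      congr 1
      field_simp
    exact (h2 ▸ h1).subtype_mk _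

/-! ### §5 The collar of the fibre is a product -/

/-- **The collar of the regular fibre is a product** (Kas 1980, §2; Milnor's flow-out collar
inside the fibres): for flow-out data `D` and `‖c₀‖ < 1` there is `t₀ > 0` with
`{x ∈ W | f x = c₀ ∧ σ x ≤ t₀} ≃ₜ {y ∈ ∂W | f y = c₀} × [0, t₀]`, the homeomorphism being
`x ↦ (ret x, σ x)` with inverse the flow-out `(y, s) ↦ Fl y s` of the fibre-preserving flow-out
data. [cite: Kas1980, §2] [cite: MilnorHCobordism1965, proof of Thm. 3.4] -/
theorem nonempty_homeomorph_fibreCollar_prod (P : PALF o b) (D : FlowoutInput 3 W)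
    {c₀ : EuclideanSpace ℝ (Fin 2)} (hc₀ : ‖c₀‖ < 1) :
    ∃ t₀ : ℝ, 0 < t₀ ∧
      Nonempty ({x : W // P.f x = c₀ ∧ D.f x ≤ t₀} ≃ₜ
        {y : b.carrier // P.f (b.incl y) = c₀} × Icc (0 : ℝ) t₀) := by
  haveI : Nonempty b.carrier := P.nonempty_carrier
  set r : ℝ := (‖c₀‖ + 1) / 2 with hr
  have hr0 : 0 < r := by rw [hr]; linarith [norm_nonneg c₀]
  have hr1 : r < 1 := by rw [hr]; linarith
  have hc₀r : ‖c₀‖ < r := by rw [hr]; linarith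
  obtain ⟨D', s, hs, hfeq, hpres0⟩ := P.exists_flowoutInput_mfderiv_eq_zero D hr0 hr1
  have hpres : ∀ x, ‖P.f x‖ ≤ r → D'.f x ≤ s →
      mfderiv (𝓡∂ 4) 𝓘(ℝ, EuclideanSpace ℝ (Fin 2)) P.f x (D'.ξ x) = 0 :=
    fun x h1 h2 => hpres0 x h1 (by rw [← hfeq]; exact h2)
  obtain ⟨Γ⟩ := D'.nonempty_cover
  set O := Γ.openCollarData b with hO
  set t₀ : ℝ := min (Γ.a / 2) s with ht₀
  have ht₀0 : 0 < t₀ := lt_min (by linarith [Γ.a_pos]) hs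
  have ht₀a : t₀ < Γ.a := lt_of_le_of_lt (min_le_left _ _) (by linarith [Γ.a_pos])
  have ht₀s : t₀ ≤ s := min_le_right _ _
  have hσ0 : ∀ y : b.carrier, D'.f (b.incl y) = 0 := fun y => D'.f_incl b y
  have ha0 : Γ.a ≠ 0 := Γ.a_pos.ne'
  refine ⟨t₀, ht₀0, ?_⟩
  -- the flow-out `(y, s) ↦ Fl (incl y) s`
  have hflow : ∀ p : {y : b.carrier // P.f (b.incl y) = c₀} × Icc (0 : ℝ) t₀,
      P.f (Γ.Fl (b.incl p.1.1) p.2.1) = c₀ ∧ D.f (Γ.Fl (b.incl p.1.1) p.2.1) ≤ t₀ := by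
    rintro ⟨y, ⟨u, hu0, hut⟩⟩
    have hza : D'.f (b.incl y.1) ≤ Γ.a := by rw [hσ0]; exact Γ.a_pos.le
    have huI : u ∈ Icc (-D'.f (b.incl y.1)) Γ.a := by
      rw [hσ0, neg_zero]; exact ⟨hu0, hut.trans ht₀a.le⟩
    constructor
    · show P.f (Γ.Fl (b.incl y.1) u) = c₀
      rw [P.apply_Fl_eq Γ hpres hza (by rw [y.2]; exact hc₀r) (by rw [hσ0]; exact hs.le) huI
        (by rw [hσ0, zero_add]; exact hut.trans ht₀s), y.2]
    · show D.f (Γ.Fl (b.incl y.1) u) ≤ t₀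
      rw [← hfeq, Γ.f_Fl hza huI, hσ0, zero_add]; exact hut
  -- the retraction `x ↦ (ret x, σ x)`
  have hret : ∀ x : {x : W // P.f x = c₀ ∧ D.f x ≤ t₀},
      P.f (b.incl (b.inclInv (Γ.ret x.1))) = c₀ ∧ D.f x.1 ∈ Icc (0 : ℝ) t₀ := by
    intro x
    have hσx : D'.f x.1 ≤ t₀ := by rw [hfeq]; exact x.2.2
    have hxa : D'.f x.1 ≤ Γ.a := hσx.trans ht₀a.le
    refine ⟨?_, D.f_nonneg x.1, x.2.2⟩
    rw [b.incl_inclInv (Γ.ret_mem_boundary hxa)]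
    show P.f (Γ.Fl x.1 (-D'.f x.1)) = c₀
    rw [P.apply_Fl_eq Γ hpres hxa (by rw [x.2.1]; exact hc₀r) (hσx.trans ht₀s)
      ⟨le_rfl, by linarith [D'.f_nonneg x.1, Γ.a_pos]⟩ (by rw [add_neg_cancel]; exact hs.le), x.2.1]
  refine ⟨{ toFun := fun x => (⟨b.inclInv (Γ.ret x.1), (hret x).1⟩, ⟨D.f x.1, (hret x).2⟩)
            invFun := fun p => ⟨Γ.Fl (b.incl p.1.1) p.2.1, hflow p⟩
            left_inv := fun x => ?_
            right_inv := fun p => ?_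
            continuous_toFun := ?_
            continuous_invFun := ?_ }⟩
  · apply Subtype.ext
    have hσx : D'.f x.1 ≤ t₀ := by rw [hfeq]; exact x.2.2
    have hxa : D'.f x.1 ≤ Γ.a := hσx.trans ht₀a.le
    show Γ.Fl (b.incl (b.inclInv (Γ.ret x.1))) (D.f x.1) = x.1
    rw [b.incl_inclInv (Γ.ret_mem_boundary hxa), ← hfeq]
    exact Γ.Fl_ret hxa
  · obtain ⟨y, ⟨u, hu0, hut⟩⟩ := p
    have hza : D'.f (b.incl y.1) ≤ Γ.a := by rw [hσ0]; exact Γ.a_pos.le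
    have huI : u ∈ Icc (-D'.f (b.incl y.1)) Γ.a := by
      rw [hσ0, neg_zero]; exact ⟨hu0, hut.trans ht₀a.le⟩
    apply Prod.ext
    · apply Subtype.ext
      show b.inclInv (Γ.ret (Γ.Fl (b.incl y.1) u)) = y.1
      rw [Γ.ret_Fl (hσ0 y.1) ⟨hu0, hut.trans ht₀a.le⟩, b.inclInv_incl]
    · apply Subtype.ext
      show D.f (Γ.Fl (b.incl y.1) u) = u
      rw [← hfeq, Γ.f_Fl hza huI, hσ0, zero_add]
  · have hcont : ContinuousOn O.proj O.region := O.contMDiffOn_proj.continuousOn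
    have h1 : Continuous fun x : {x : W // P.f x = c₀ ∧ D.f x ≤ t₀} => O.proj x.1 := by
      refine hcont.comp_continuous continuous_subtype_val fun x => ?_
      show D'.f x.1 < Γ.a
      rw [hfeq]; exact lt_of_le_of_lt x.2.2 ht₀a
    have h2 : Continuous fun x : {x : W // P.f x = c₀ ∧ D.f x ≤ t₀} => D.f x.1 :=
      D.f_smooth.continuous.comp continuous_subtype_val
    exact (h1.subtype_mk _).prodMk (h2.subtype_mk _)
  · have hcont : ContinuousOn (uncurry O.toFun) (univ ×ˢ Ico 0 O.top) := O.contMDiffOn_toFun.continuousOn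
    have hmem : ∀ p : {y : b.carrier // P.f (b.incl y) = c₀} × Icc (0 : ℝ) t₀,
        ((p.1.1, 2 * p.2.1 / Γ.a) : b.carrier × ℝ) ∈ univ ×ˢ Ico (0 : ℝ) O.top := by
      intro p
      refine ⟨mem_univ _, ?_⟩
      show 2 * p.2.1 / Γ.a ∈ Ico (0 : ℝ) 2
      refine ⟨div_nonneg (by linarith [p.2.2.1]) Γ.a_pos.le, ?_⟩
      rw [div_lt_iff₀ Γ.a_pos]; linarith [p.2.2.2]
    have h1 : Continuous fun p : {y : b.carrier // P.f (b.incl y) = c₀} × Icc (0 : ℝ) t₀ =>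
        uncurry O.toFun (p.1.1, 2 * p.2.1 / Γ.a) :=
      hcont.comp_continuous ((continuous_subtype_val.comp continuous_fst).prodMk
        ((continuous_const.mul (continuous_subtype_val.comp continuous_snd)).div_const _)) hmem
    have h2 : (fun p : {y : b.carrier // P.f (b.incl y) = c₀} × Icc (0 : ℝ) t₀ =>
          Γ.Fl (b.incl p.1.1) p.2.1) =
        fun p => uncurry O.toFun (p.1.1, 2 * p.2.1 / Γ.a) := by
      funext p
      show Γ.Fl (b.incl p.1.1) p.2.1 = Γ.Fl (b.incl p.1.1) (2 * p.2.1 / Γ.a * (Γ.a / 2))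
      congr 1
      field_simp
    exact (h2 ▸ h1).subtype_mk _

end PALF

end Literature.Geometry.Symplectic

end
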